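import Summits.MatrixMultiplication.MatrixMultiplication.Theorems.SaturationLadderGaugeCone
import Literature.Computability.AlgebraicComplexity.LaserSymmetrization
import HarnessLib

/-!
# Route `SaturationLadder` — CATALYTIC TRANSFER I: base-side catalysts `⟨s⟩` in the certificate engine and the shifted
format laws (decomp-mm lens 1 «grading / quantitative ladder», gen 30; route-free helper: imports NO `Theses` file)

Gens 25–29 price a certificate `T^{⊠N} ⊵ ⟨t⟩ ⊗ ⟨q^a,q^b,q^c⟩` (target-side diagonal `⟨t⟩` = CLLZ's catalyticity,
[ChristandlLeGallLysikovZuiddam2020, §1.3.3 and Def. 3.10]) by the three gauge floors, derive the TRANSFER LAWS of exact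
format-to-format certificates (`b·a' ≤ a·b'`, `b·c' ≤ c·b'`, gen 27), their defect versions (gen 28) and the closure of every
gauge class `G_{λ,μ}` under them (gen 29).  The one in-class escape still recorded as PROSE (gen 29 memo §4(a); critic g29 r3)
is the BASE-SIDE catalyst: `⟨s⟩ ⊗ T^{⊠N} ⊵ ⟨t⟩ ⊗ ⟨q^a,q^b,q^c⟩`, exponent bound `U_cat := (N·log R̃(T) + log s − log t)/log q`.
This file types it.  §1: the catalytic packing `t·F(target) ≤ s·F(T)^N` at every universal spectral point, the catalytic
certificate `t·q^{ω(a,b,c)} ≤ s·R̃(T)^N` (Schönhage à la ADVXXZ Thm. 3.2, `R̃` sub-multiplicative, `R̃(⟨s⟩) ≤ s`), the bound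
`ω(a,b,c) ≤ U_cat`, and: an EXACT catalytic certificate (`U_cat ≤ a+c`) still forces a FLAT base `R̃(T) = ζ⁽¹⁾(T)` — the
catalyst enters the certificate and the `ζ⁽¹⁾`-packing with the same sign and cancels.  §2: for a format base
`⟨p^{a'},p^{b'},p^{c'}⟩` the three log-packings acquire the summand `log s`.  §3: the catalytic SKELETON — with
`σ := log s − log t`, `Y := N·log p`, `L := log q`: saturation `log t + (a+c)L = log s + (a'+c')Y`, base tightness
`(ω' − (a'+c'))·Y = 0`, the two excess inequalities VERBATIM (`σ` cancels) and the two input-leg packings shifted by `σ`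
(so the target is inner-bound, as in gen 27).  §4: the CATALYTIC LAWS `2b·a'·L ≤ 2a·b'·L + (a'−b')σ`, `2b·c'·L ≤ 2c·b'·L + (c'−b')σ` and their
integrality: `(a'−b')σ < 2L ⟹ b·a' ≤ a·b'`, `(c'−b')σ < 2L ⟹ b·c' ≤ c·b'` in `ℕ`.  The companion `…CatalyticTransferCone`
reads off: `s ≤ t` obeys the exact laws; a catalyst is a defect `log⁺(s/t)/log q`; every gauge class is closed under catalytic
transfers; onset rigidity survives.  Support module beneath stmt-MatrixMultiplication-25909; closes no item; 0 sorry; no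
definitions; imports only BUILT modules.
[cite: ChristandlLeGallLysikovZuiddam2020, §1.3.3, Def. 3.10, Thm. 3.11 and Lemma 4.1; ChristandlVranaZuiddam2023, §1.2 and
Example 1.4; AlmanDuanVassilevskaWilliamsXuXuZhou2025, Thm. 3.2 and §3.4; LottiRomani1983, §1 (p. 173)]
-/

set_option linter.dupNamespace false

noncomputable section

open scoped BigOperators

namespace Summit.MatrixMultiplication.MatrixMultiplication.Theorems.SaturationLadderCatalyticTransfer

open Literature.Computability.AlgebraicComplexity
open Literature.Barriers.MatrixMultiplication
open Summit.MatrixMultiplication.MatrixMultiplication.Theorems.ConverseDoorLimit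
  (spectral_le_of_polyDegeneratesTo map_unitTensor)  -- landed, imported
open Summit.MatrixMultiplication.MatrixMultiplication.Theorems.SaturationLadderFlatFormats
  (flatteningRank_matMulTensor_rect)  -- landed, imported

variable {K : Type} [Field K]
variable {ι κ μ : Type} [Fintype ι] [Fintype κ] [Fintype μ]

/-! ## 1. The catalytic packing and the catalytic certificate (arbitrary base) -/

section Packing

/-- **Catalytic packing at a universal spectral point**: `⟨s⟩ ⊗ T^{⊠N} ⊵ ⟨t⟩ ⊗ ⟨A,B,C⟩` gives
`t · F(⟨A,B,C⟩) ≤ s · F(T)^N` (monotonicity, multiplicativity, `F(⟨n⟩) = n`).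
[cite: ChristandlLeGallLysikovZuiddam2020, §1.3.3 and Lemma 4.1; Strassen1988, §2 (asymptotic spectrum)] -/
theorem catalytic_spectral_packing_le {F : SpectralMap K} (hF : IsUniversalSpectralPoint K F)
    (T : ι → κ → μ → K) (s N t A B C : ℕ)
    (h : PolyDegeneratesTo (kroneckerTensor (unitTensor K s) (kroneckerPow T N))
      (kroneckerTensor (unitTensor K t) (matMulTensor K A B C))) :
    (t : ℝ) * F (matMulTensor K A B C) ≤ (s : ℝ) * F T ^ N := by
  have h1 := spectral_le_of_polyDegeneratesTo hF h
  rw [hF.map_kronecker, hF.map_kronecker, map_unitTensor hF, map_unitTensor hF, hF.map_kroneckerPow] at h1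
  exact h1

/-- **Catalytic output-leg packing** `t · AC ≤ s · ζ⁽¹⁾(T)^N` (`B ≥ 1`). [cite: ChristandlVranaZuiddam2023, Example 1.4] -/
theorem catalytic_gauge₁_packing_le (T : ι → κ → μ → K) (s N t A B C : ℕ) (hB : 0 < B)
    (h : PolyDegeneratesTo (kroneckerTensor (unitTensor K s) (kroneckerPow T N))
      (kroneckerTensor (unitTensor K t) (matMulTensor K A B C))) :
    (t : ℝ) * ((A * C : ℕ) : ℝ) ≤ (s : ℝ) * (flatteningRank T : ℝ) ^ N := by
  have h1 := catalytic_spectral_packing_le (gaugePoint₁_isUniversalSpectralPoint K) T s N t A B C h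
  rwa [gaugePoint₁_matMulTensor hB, gaugePoint₁_eq] at h1

/-- **Catalytic first-input-leg packing** `t · AB ≤ s · ζ⁽²⁾(T)^N` (`C ≥ 1`). [cite: ChristandlVranaZuiddam2023, Example 1.4] -/
theorem catalytic_gauge₂_packing_le (T : ι → κ → μ → K) (s N t A B C : ℕ) (hC : 0 < C)
    (h : PolyDegeneratesTo (kroneckerTensor (unitTensor K s) (kroneckerPow T N))
      (kroneckerTensor (unitTensor K t) (matMulTensor K A B C))) :
    (t : ℝ) * ((A * B : ℕ) : ℝ) ≤ (s : ℝ) * gaugePoint₂ K T ^ N := by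
  have h1 := catalytic_spectral_packing_le (gaugePoint₂_isUniversalSpectralPoint K) T s N t A B C h
  rwa [gaugePoint₂_matMulTensor hC] at h1

/-- **Catalytic second-input-leg packing** `t · CB ≤ s · ζ⁽³⁾(T)^N` (`A ≥ 1`). [cite: ChristandlVranaZuiddam2023, Example 1.4] -/
theorem catalytic_gauge₃_packing_le (T : ι → κ → μ → K) (s N t A B C : ℕ) (hA : 0 < A)
    (h : PolyDegeneratesTo (kroneckerTensor (unitTensor K s) (kroneckerPow T N))
      (kroneckerTensor (unitTensor K t) (matMulTensor K A B C))) :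
    (t : ℝ) * ((C * B : ℕ) : ℝ) ≤ (s : ℝ) * gaugePoint₃ K T ^ N := by
  have h1 := catalytic_spectral_packing_le (gaugePoint₃_isUniversalSpectralPoint K) T s N t A B C h
  rwa [gaugePoint₃_matMulTensor hA] at h1

end Packing

section Certificate

/-- **The catalytic certificate**: `⟨s⟩ ⊗ T^{⊠N} ⊵ ⟨t⟩ ⊗ ⟨q^a,q^b,q^c⟩` (`N ≥ 1`, `q ≥ 2`, `t ≥ 1`) with `R̃(T) ≤ r` gives
`t · q^{ω(a,b,c)} ≤ s · r^N` (Schönhage, `R̃` monotone under degeneration and sub-multiplicative under `⊗`, `R̃(⟨s⟩) ≤ s`).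
[cite: AlmanDuanVassilevskaWilliamsXuXuZhou2025, Thm. 3.2; ChristandlLeGallLysikovZuiddam2020, Def. 3.10] -/
theorem catalytic_certificate_mul_rpow_le [DecidableEq ι] [DecidableEq κ] [DecidableEq μ]
    (T : ι → κ → μ → K) {N : ℕ} (hN : 0 < N) {q : ℕ} (hq : 2 ≤ q)
    (a b c : ℕ) {s t : ℕ} (ht : 1 ≤ t)
    (h : PolyDegeneratesTo (kroneckerTensor (unitTensor K s) (kroneckerPow T N))
      (kroneckerTensor (unitTensor K t) (matMulTensor K (q ^ a) (q ^ b) (q ^ c))))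
    {r : ℝ} (hr : asymptoticRank T ≤ r) :
    (t : ℝ) * (q : ℝ) ^ omegaRect K a b c ≤ (s : ℝ) * r ^ N := by
  have h1 := advxxz2025_thm32 K hq a b c ht
  have h2 := asymptoticRank_le_of_polyDegeneratesTo h
  have h3 := asymptoticRank_kronecker_le (unitTensor K s) (kroneckerPow T N)
  have h4 := asymptoticRank_unitTensor_le (K := K) s
  have h5 := (asymptoticRank_kroneckerPow_le T hN).trans (pow_le_pow_left₀ (asymptoticRank_nonneg _) hr N)
  exact h1.trans (h2.trans (h3.trans (mul_le_mul h4 h5 (asymptoticRank_nonneg _) (Nat.cast_nonneg s))))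

/-- … so the catalytic certificate proves **`ω(a,b,c) ≤ U_cat := (N·log r + log s − log t)/log q`** (`s ≥ 1`).
[cite: ChristandlLeGallLysikovZuiddam2020, Def. 3.10 and Thm. 3.11; AlmanDuanVassilevskaWilliamsXuXuZhou2025, Thm. 3.2] -/
theorem catalytic_certificate_omegaRect_le [DecidableEq ι] [DecidableEq κ] [DecidableEq μ]
    (T : ι → κ → μ → K) {N : ℕ} (hN : 0 < N) {q : ℕ} (hq : 2 ≤ q)
    (a b c : ℕ) {s t : ℕ} (hs : 1 ≤ s) (ht : 1 ≤ t)
    (h : PolyDegeneratesTo (kroneckerTensor (unitTensor K s) (kroneckerPow T N))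
      (kroneckerTensor (unitTensor K t) (matMulTensor K (q ^ a) (q ^ b) (q ^ c))))
    {r : ℝ} (hr : asymptoticRank T ≤ r) :
    omegaRect K a b c ≤ ((N : ℝ) * Real.log r + Real.log s - Real.log t) / Real.log q := by
  have hle := catalytic_certificate_mul_rpow_le T hN hq a b c ht h hr
  have ht0 : (0 : ℝ) < t := by exact_mod_cast (by omega : 0 < t)
  have hs0 : (0 : ℝ) < s := by exact_mod_cast (by omega : 0 < s)
  have hq1 : (1 : ℝ) < q := by exact_mod_cast (by omega : 1 < q)
  have hq0 : (0 : ℝ) < q := by linarith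
  have hlogq : 0 < Real.log q := Real.log_pos hq1
  have hlhs : 0 < (t : ℝ) * (q : ℝ) ^ omegaRect K a b c := mul_pos ht0 (Real.rpow_pos_of_pos hq0 _)
  have hsrN : 0 < (s : ℝ) * r ^ N := hlhs.trans_le hle
  have hrN : 0 < r ^ N := pos_of_mul_pos_of_nonneg_left' hsrN hs0.le
  have hr0 : 0 < r := by
    rcases lt_trichotomy r 0 with hneg | hzero | hpos
    · exact absurd (lt_of_le_of_lt ((asymptoticRank_nonneg T).trans hr) hneg) (lt_irrefl _)
    · rw [hzero, zero_pow (by omega : N ≠ 0)] at hrN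
      exact absurd hrN (lt_irrefl _)
    · exact hpos
  have hlog := Real.log_le_log hlhs hle
  rw [Real.log_mul ht0.ne' (Real.rpow_pos_of_pos hq0 _).ne', Real.log_rpow hq0,
    Real.log_mul hs0.ne' hrN.ne', Real.log_pow] at hlog
  rw [le_div_iff₀ hlogq]
  linarith
where
  /-- `0 < s·x`, `0 ≤ s` ⟹ `0 < x`. -/
  pos_of_mul_pos_of_nonneg_left' {u x : ℝ} (hux : 0 < u * x) (hu : 0 ≤ u) : 0 < x := by
    by_contra hx
    exact absurd hux (not_lt.2 (mul_nonpos_of_nonneg_of_nonpos hu (not_lt.1 hx)))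

/-- **An EXACT catalytic certificate forces a flat base**: if `⟨s⟩ ⊗ T^{⊠N} ⊵ ⟨t⟩ ⊗ ⟨q^a,q^b,q^c⟩` (`N ≥ 1`) is exact in
the sense `U_cat = (N·log R̃(T) + log s − log t)/log q ≤ a + c`, then `R̃(T) = ζ⁽¹⁾(T)` — the catalyst `log s` enters the
certificate and the `ζ⁽¹⁾`-packing with the same sign and cancels (gen 25 `asymptoticRank_eq_flatteningRank_of_exact` is the
case `s = 1`).  Catalysts do not let non-flat bases transfer exactly. [cite: ChristandlVranaZuiddam2023, §1.2 and Example 1.4;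
ChristandlLeGallLysikovZuiddam2020, Thm. 3.11] -/
theorem catalytic_exact_forces_flat [DecidableEq ι] [DecidableEq κ] [DecidableEq μ]
    (T : ι → κ → μ → K) {N : ℕ} (hN : 0 < N) {q : ℕ} (hq : 2 ≤ q)
    {a b c s t : ℕ} (hs : 1 ≤ s) (ht : 1 ≤ t) (hT : 1 ≤ flatteningRank T)
    (h : PolyDegeneratesTo (kroneckerTensor (unitTensor K s) (kroneckerPow T N))
      (kroneckerTensor (unitTensor K t) (matMulTensor K (q ^ a) (q ^ b) (q ^ c))))
    (hU : ((N : ℝ) * Real.log (asymptoticRank T) + Real.log s - Real.log t) / Real.log q ≤ ((a + c : ℕ) : ℝ)) :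
    asymptoticRank T = flatteningRank T := by
  have hζR := flatteningRank_le_asymptoticRank T
  refine le_antisymm ?_ hζR
  have hζ1 : (1 : ℝ) ≤ (flatteningRank T : ℝ) := by exact_mod_cast hT
  have hζ0 : (0 : ℝ) < (flatteningRank T : ℝ) := by linarith
  have hR0 : 0 < asymptoticRank T := hζ0.trans_le hζR
  have ht0 : (0 : ℝ) < t := by exact_mod_cast (by omega : 0 < t)
  have hs0 : (0 : ℝ) < s := by exact_mod_cast (by omega : 0 < s)
  have hq1 : (1 : ℝ) < q := by exact_mod_cast (by omega : 1 < q)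
  have hq0 : (0 : ℝ) < q := by linarith
  have hL : 0 < Real.log q := Real.log_pos hq1
  -- the `ζ⁽¹⁾`-packing: `t·q^{a+c} ≤ s·ζ⁽¹⁾(T)^N`, in logarithms
  have hpack := catalytic_gauge₁_packing_le T s N t (q ^ a) (q ^ b) (q ^ c) (pow_pos (by omega) b) h
  have he : (((q ^ a * q ^ c : ℕ)) : ℝ) = (q : ℝ) ^ (a + c) := by push_cast; ring
  rw [he] at hpack
  have hqs : (0 : ℝ) < (q : ℝ) ^ (a + c) := pow_pos hq0 _
  have hlog := Real.log_le_log (mul_pos ht0 hqs) hpack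
  rw [Real.log_mul ht0.ne' hqs.ne', Real.log_pow, Real.log_mul hs0.ne' (pow_pos hζ0 N).ne', Real.log_pow] at hlog
  -- exactness: `N·log R̃ + log s − log t ≤ (a+c)·log q`
  have hUL := (div_le_iff₀ hL).1 hU
  push_cast at hlog hUL
  have hN1 : (0 : ℝ) < N := by exact_mod_cast hN
  have key : (N : ℝ) * Real.log (asymptoticRank T) ≤ (N : ℝ) * Real.log (flatteningRank T : ℝ) := by linarith
  have key' := le_of_mul_le_mul_left key hN1
  exact (Real.log_le_log_iff hR0 hζ0).1 key'

end Certificate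

/-! ## 2. Format bases: the three catalytic log-packings -/

section Legs

/-- Real-arithmetic core: `t ≥ 1`, `q ≥ 2`, `S ≥ 1`, `t · q^e ≤ S · (p^{e'})^N` ⟹ `log t + e·log q ≤ log S + N·(e'·log p)`. [folklore] -/
theorem log_of_catalyticPacking {t q p e e' N S : ℕ} (ht : 1 ≤ t) (hq : 2 ≤ q) (hS : 1 ≤ S)
    (hpack : (t : ℝ) * (q : ℝ) ^ e ≤ (S : ℝ) * ((p : ℝ) ^ e') ^ N) :
    Real.log t + (e : ℝ) * Real.log q ≤ Real.log S + (N : ℝ) * ((e' : ℝ) * Real.log p) := by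
  have ht0 : (0 : ℝ) < t := by exact_mod_cast (by omega : 0 < t)
  have hq0 : (0 : ℝ) < q := by exact_mod_cast (by omega : 0 < q)
  have hS0 : (0 : ℝ) < S := by exact_mod_cast (by omega : 0 < S)
  have hqs : (0 : ℝ) < (q : ℝ) ^ e := pow_pos hq0 e
  have hP0 : (0 : ℝ) ≤ ((p : ℝ) ^ e') ^ N := by positivity
  have hP : (0 : ℝ) < ((p : ℝ) ^ e') ^ N := by
    rcases hP0.lt_or_eq with hpos | hzero
    · exact hpos
    · rw [← hzero, mul_zero] at hpack
      exact absurd hpack (not_le.2 (mul_pos ht0 hqs))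
  have hlog := Real.log_le_log (mul_pos ht0 hqs) hpack
  rw [Real.log_mul ht0.ne' hqs.ne', Real.log_mul hS0.ne' hP.ne', Real.log_pow, Real.log_pow, Real.log_pow] at hlog
  linarith

variable {p a' b' c' N s t q a b c : ℕ}

/-- **Catalytic output-leg packing** `t·q^{a+c} ≤ s·p^{N(a'+c')}`, in logarithms. [cite: ChristandlVranaZuiddam2023, Example 1.4] -/
theorem catalytic_logPacking₁ (hp : 2 ≤ p) (hq : 2 ≤ q) (hs : 1 ≤ s) (ht : 1 ≤ t)
    (h : PolyDegeneratesTo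
      (kroneckerTensor (unitTensor K s) (kroneckerPow (matMulTensor K (p ^ a') (p ^ b') (p ^ c')) N))
      (kroneckerTensor (unitTensor K t) (matMulTensor K (q ^ a) (q ^ b) (q ^ c)))) :
    Real.log t + ((a + c : ℕ) : ℝ) * Real.log q ≤
      Real.log s + (N : ℝ) * (((a' + c' : ℕ) : ℝ) * Real.log p) := by
  have hpack := catalytic_gauge₁_packing_le _ s N t (q ^ a) (q ^ b) (q ^ c) (pow_pos (by omega) b) h
  rw [flatteningRank_matMulTensor_rect (K := K) (by omega) a' b' c'] at hpack
  have he : (((q ^ a * q ^ c : ℕ)) : ℝ) = (q : ℝ) ^ (a + c) := by push_cast; ring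
  rw [he] at hpack
  exact log_of_catalyticPacking ht hq hs hpack

/-- **Catalytic first-input-leg packing** `t·q^{a+b} ≤ s·p^{N(a'+b')}`, in logarithms. [cite: ChristandlVranaZuiddam2023, Example 1.4] -/
theorem catalytic_logPacking₂ (hp : 2 ≤ p) (hq : 2 ≤ q) (hs : 1 ≤ s) (ht : 1 ≤ t)
    (h : PolyDegeneratesTo
      (kroneckerTensor (unitTensor K s) (kroneckerPow (matMulTensor K (p ^ a') (p ^ b') (p ^ c')) N))
      (kroneckerTensor (unitTensor K t) (matMulTensor K (q ^ a) (q ^ b) (q ^ c)))) :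
    Real.log t + ((a + b : ℕ) : ℝ) * Real.log q ≤
      Real.log s + (N : ℝ) * (((a' + b' : ℕ) : ℝ) * Real.log p) := by
  have hpack := catalytic_gauge₂_packing_le _ s N t (q ^ a) (q ^ b) (q ^ c) (pow_pos (by omega) c) h
  rw [gaugePoint₂_matMulTensor (K := K) (pow_pos (by omega) c')] at hpack
  have he : (((q ^ a * q ^ b : ℕ)) : ℝ) = (q : ℝ) ^ (a + b) := by push_cast; ring
  have he' : (((p ^ a' * p ^ b' : ℕ)) : ℝ) = (p : ℝ) ^ (a' + b') := by push_cast; ring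
  rw [he, he'] at hpack
  exact log_of_catalyticPacking ht hq hs hpack

/-- **Catalytic second-input-leg packing** `t·q^{b+c} ≤ s·p^{N(b'+c')}`, in logarithms. [cite: ChristandlVranaZuiddam2023, Example 1.4] -/
theorem catalytic_logPacking₃ (hp : 2 ≤ p) (hq : 2 ≤ q) (hs : 1 ≤ s) (ht : 1 ≤ t)
    (h : PolyDegeneratesTo
      (kroneckerTensor (unitTensor K s) (kroneckerPow (matMulTensor K (p ^ a') (p ^ b') (p ^ c')) N))
      (kroneckerTensor (unitTensor K t) (matMulTensor K (q ^ a) (q ^ b) (q ^ c)))) :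
    Real.log t + ((b + c : ℕ) : ℝ) * Real.log q ≤
      Real.log s + (N : ℝ) * (((b' + c' : ℕ) : ℝ) * Real.log p) := by
  have hpack := catalytic_gauge₃_packing_le _ s N t (q ^ a) (q ^ b) (q ^ c) (pow_pos (by omega) a) h
  rw [gaugePoint₃_matMulTensor (K := K) (pow_pos (by omega) a')] at hpack
  have he : (((q ^ c * q ^ b : ℕ)) : ℝ) = (q : ℝ) ^ (b + c) := by push_cast; ring
  have he' : (((p ^ c' * p ^ b' : ℕ)) : ℝ) = (p : ℝ) ^ (b' + c') := by push_cast; ring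
  rw [he, he'] at hpack
  exact log_of_catalyticPacking ht hq hs hpack

end Legs

/-! ## 3. The catalytic skeleton of an exact certificate between formats -/

section Catalytic

variable {p a' b' c' N s t q a b c : ℕ} (hp : 2 ≤ p) (hq : 2 ≤ q) (hs : 1 ≤ s) (ht : 1 ≤ t)
  (h : PolyDegeneratesTo
    (kroneckerTensor (unitTensor K s) (kroneckerPow (matMulTensor K (p ^ a') (p ^ b') (p ^ c')) N))
    (kroneckerTensor (unitTensor K t) (matMulTensor K (q ^ a) (q ^ b) (q ^ c))))
  (hU : ((N : ℝ) * (omegaRect K a' b' c' * Real.log p) + Real.log s - Real.log t) / Real.log q ≤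
    ((a + c : ℕ) : ℝ))
include hp hq hs ht h hU

/-- **The catalytic skeleton** of an exact catalytic certificate `⟨s⟩ ⊗ ⟨p^{a'},p^{b'},p^{c'}⟩^{⊠N} ⊵ ⟨t⟩ ⊗ ⟨q^a,q^b,q^c⟩`
(`U_cat ≤ a + c`): with `L = log q > 0`, `Y = N·log p ≥ 0`, `σ = log s − log t` — base tightness in the
form `(ω(a',b',c') − (a'+c'))·Y = 0` (so the base is tight as soon as `N ≥ 1`), SATURATION `log t + (a+c)L = log s + (a'+c')Y`,
the two EXCESS inequalities verbatim as in the catalyst-free skeleton (`σ` cancels), and the two input-leg packings shifted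
by `σ`. [cite: ChristandlLeGallLysikovZuiddam2020, §1.3.3, Def. 3.10, Thm. 3.11 and Lemma 4.1; LottiRomani1983, §1 (p. 173)] -/
theorem catalytic_skeleton :
    0 < Real.log q ∧ 0 ≤ (N : ℝ) * Real.log p ∧
    (omegaRect K a' b' c' - ((a' : ℝ) + c')) * ((N : ℝ) * Real.log p) = 0 ∧
    Real.log t + ((a : ℝ) + c) * Real.log q =
      Real.log s + ((a' : ℝ) + c') * ((N : ℝ) * Real.log p) ∧
    ((a' : ℝ) - b') * ((N : ℝ) * Real.log p) ≤ ((a : ℝ) - b) * Real.log q ∧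
    ((c' : ℝ) - b') * ((N : ℝ) * Real.log p) ≤ ((c : ℝ) - b) * Real.log q ∧
    ((a : ℝ) + b) * Real.log q ≤
      ((a' : ℝ) + b') * ((N : ℝ) * Real.log p) + (Real.log s - Real.log t) ∧
    ((b : ℝ) + c) * Real.log q ≤
      ((b' : ℝ) + c') * ((N : ℝ) * Real.log p) + (Real.log s - Real.log t) := by
  have hq1 : (1 : ℝ) < q := by exact_mod_cast (by omega : 1 < q)
  have hL : 0 < Real.log q := Real.log_pos hq1
  have hp1 : (1 : ℝ) < p := by exact_mod_cast (by omega : 1 < p)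
  have hlogp : 0 < Real.log p := Real.log_pos hp1
  have hN0 : (0 : ℝ) ≤ N := Nat.cast_nonneg N
  have hY : 0 ≤ (N : ℝ) * Real.log p := mul_nonneg hN0 hlogp.le
  have l1 := catalytic_logPacking₁ (K := K) hp hq hs ht h
  have l2 := catalytic_logPacking₂ (K := K) hp hq hs ht h
  have l3 := catalytic_logPacking₃ (K := K) hp hq hs ht h
  have hUL := (div_le_iff₀ hL).1 hU
  have hω := add_le_omegaRect₁₃ K (a' : ℝ) b' c'
  push_cast at l1 l2 l3 hUL hω
  -- `(a'+c')·Y ≤ ω'·Y ≤ (a'+c')·Y`: exactness squeezed against the output-leg packing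
  have hωY : ((a' : ℝ) + c') * ((N : ℝ) * Real.log p) ≤ omegaRect K a' b' c' * ((N : ℝ) * Real.log p) :=
    mul_le_mul_of_nonneg_right hω hY
  have e1 : (N : ℝ) * (omegaRect K a' b' c' * Real.log p) = omegaRect K a' b' c' * ((N : ℝ) * Real.log p) := by
    ring
  rw [e1] at hUL
  have hsat : Real.log t + ((a : ℝ) + c) * Real.log q =
      Real.log s + ((a' : ℝ) + c') * ((N : ℝ) * Real.log p) := by linarith
  have htight : (omegaRect K a' b' c' - ((a' : ℝ) + c')) * ((N : ℝ) * Real.log p) = 0 := by nlinarith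
  refine ⟨hL, hY, htight, hsat, by linarith, by linarith, by linarith, by linarith⟩

/-- **Base tightness** (`N ≥ 1`): an exact catalytic certificate has a tight, inner-bound base
`ω(a',b',c') = a'+c'`, `b' ≤ a'`, `b' ≤ c'` — no catalyst makes a non-tight format transfer exactly. [cite: LottiRomani1983, §1 (p. 173)] -/
theorem catalytic_base_tight (hN : 1 ≤ N) :
    omegaRect K a' b' c' = ((a' + c' : ℕ) : ℝ) ∧ b' ≤ a' ∧ b' ≤ c' := by
  obtain ⟨-, -, htight, -, -, -, -, -⟩ := catalytic_skeleton hp hq hs ht h hU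
  have hp1 : (1 : ℝ) < p := by exact_mod_cast (by omega : 1 < p)
  have hlogp : 0 < Real.log p := Real.log_pos hp1
  have hN1 : (1 : ℝ) ≤ N := by exact_mod_cast hN
  have hY : 0 < (N : ℝ) * Real.log p := by nlinarith
  have hT : omegaRect K a' b' c' = (a' : ℝ) + c' := by
    have := mul_eq_zero.1 htight
    rcases this with h0 | h0
    · linarith
    · exact absurd h0 hY.ne'
  have h12 := add_le_omegaRect₁₂ K (a' : ℝ) b' c'
  have h23 := add_le_omegaRect₂₃ K (a' : ℝ) b' c'
  rw [hT] at h12 h23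
  refine ⟨by push_cast; exact hT, by exact_mod_cast (by linarith : (b' : ℝ) ≤ a'),
    by exact_mod_cast (by linarith : (b' : ℝ) ≤ c')⟩

/-! ## 4. The catalytic laws and their integrality -/

/-- **CATALYTIC THINNESS LAW** (`b' ≤ a'`): `2b·a'·L ≤ 2a·b'·L + (a'−b')·σ` with `L = log q`, `σ = log s − log t` — the
exact law `b·a' ≤ a·b'` of gen 27 shifted by the catalyst, and SHARPENED by it when `s < t`.
[cite: ChristandlLeGallLysikovZuiddam2020, Thm. 3.11 and Lemma 4.1] -/
theorem catalytic_thinness_law (hba' : b' ≤ a') :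
    2 * (b : ℝ) * a' * Real.log q ≤
      2 * (a : ℝ) * b' * Real.log q + ((a' : ℝ) - b') * (Real.log s - Real.log t) := by
  obtain ⟨hL, hY, -, -, e3, -, p2, -⟩ := catalytic_skeleton hp hq hs ht h hU
  have hba'R : (b' : ℝ) ≤ a' := by exact_mod_cast hba'
  have hd : (0 : ℝ) ≤ (a' : ℝ) - b' := by linarith
  have hS : (0 : ℝ) ≤ (a' : ℝ) + b' := by positivity
  have k1 := mul_le_mul_of_nonneg_left p2 hd
  have k2 := mul_le_mul_of_nonneg_left e3 hS
  nlinarith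

/-- **CATALYTIC LENGTH LAW** (`b' ≤ c'`): `2b·c'·L ≤ 2c·b'·L + (c'−b')·σ`. [cite: ChristandlLeGallLysikovZuiddam2020, Thm. 3.11 and Lemma 4.1] -/
theorem catalytic_length_law (hbc' : b' ≤ c') :
    2 * (b : ℝ) * c' * Real.log q ≤
      2 * (c : ℝ) * b' * Real.log q + ((c' : ℝ) - b') * (Real.log s - Real.log t) := by
  obtain ⟨hL, hY, -, -, -, e2, -, p3⟩ := catalytic_skeleton hp hq hs ht h hU
  have hbc'R : (b' : ℝ) ≤ c' := by exact_mod_cast hbc'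
  have hd : (0 : ℝ) ≤ (c' : ℝ) - b' := by linarith
  have hS : (0 : ℝ) ≤ (b' : ℝ) + c' := by positivity
  have k1 := mul_le_mul_of_nonneg_left p3 hd
  have k2 := mul_le_mul_of_nonneg_left e2 hS
  nlinarith

/-- **Integrality — SMALL CATALYSTS OBEY THE EXACT THINNESS LAW**: if `(a'−b')·(log s − log t) < 2·log q` then
`b·a' ≤ a·b'` in `ℕ`. [cite: ChristandlLeGallLysikovZuiddam2020, Thm. 3.11] -/
theorem thinness_law_of_smallCatalyst (hba' : b' ≤ a')
    (hσ : ((a' : ℝ) - b') * (Real.log s - Real.log t) < 2 * Real.log q) : b * a' ≤ a * b' := by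
  obtain ⟨hL, -, -, -, -, -, -, -⟩ := catalytic_skeleton hp hq hs ht h hU
  have hlaw := catalytic_thinness_law hp hq hs ht h hU hba'
  have key : ((2 * (b * a') : ℕ) : ℝ) * Real.log q < ((2 * (a * b') + 2 : ℕ) : ℝ) * Real.log q := by
    push_cast; nlinarith
  have key' : 2 * (b * a') < 2 * (a * b') + 2 := by exact_mod_cast lt_of_mul_lt_mul_right key hL.le
  omega

/-- **Integrality — SMALL CATALYSTS OBEY THE EXACT LENGTH LAW**: if `(c'−b')·(log s − log t) < 2·log q` then
`b·c' ≤ c·b'` in `ℕ`. [cite: ChristandlLeGallLysikovZuiddam2020, Thm. 3.11] -/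
theorem length_law_of_smallCatalyst (hbc' : b' ≤ c')
    (hσ : ((c' : ℝ) - b') * (Real.log s - Real.log t) < 2 * Real.log q) : b * c' ≤ c * b' := by
  obtain ⟨hL, -, -, -, -, -, -, -⟩ := catalytic_skeleton hp hq hs ht h hU
  have hlaw := catalytic_length_law hp hq hs ht h hU hbc'
  have key : ((2 * (b * c') : ℕ) : ℝ) * Real.log q < ((2 * (c * b') + 2 : ℕ) : ℝ) * Real.log q := by
    push_cast; nlinarith
  have key' : 2 * (b * c') < 2 * (c * b') + 2 := by exact_mod_cast lt_of_mul_lt_mul_right key hL.le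
  omega

end Catalytic

end Summit.MatrixMultiplication.MatrixMultiplication.Theorems.SaturationLadderCatalyticTransfer

end
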